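import Literature.AlgebraicGeometry.Resolution.RegularLocalRingsQuotient
import Mathlib.RingTheory.RegularLocalRing.Polynomial
import Mathlib.RingTheory.Localization.Ideal
import Mathlib.RingTheory.Localization.AtPrime.Basic
import Mathlib.RingTheory.AdjoinRoot
import HarnessLib

/-!
# Crux `FrobeniusLadder.FRationalResolution` (stmt-ResolutionOfSingularities-15317), line `redirect`,
# stub `stub_diagonalizableQuotientResolution` — item (F2b): the HYPERSURFACE CRITERION that discharges the hypothesis `hreg` of
# `…FixedChartOfRoot.exists_fixed_chart_of_rootAdjoin` (regularity of `S̃ = S[w]/(w^d − u)` at a prime)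

For a regular ring `T`, an element `f` and a prime `𝔓` of `T/(f)` with preimage `𝔓'` in `T`: `(T/(f))_𝔓 ≅ T_{𝔓'}/(f)`, and `T_{𝔓'}`
is a regular local ring; so `(T/(f))_𝔓` is regular as soon as `f ∉ (𝔓' T_{𝔓'})²` (Matsumura Thm. 14.2,
`Literature…IsRegularLocalRing.quotient_span_singleton`). With `T = S[X]` (regular when `S` is, Mathlib
`Polynomial.isRegularRing_of_isRegularRing`) and `f = X^d − C u` this is the form in which the regularity of the root-adjunction
chart `S̃ = AdjoinRoot (X^d − C u)` is to be certified: **`X^d − u ∉ 𝔓'^{(2)}`** (MEMO-15317-leafhand2-g21 §3 proves this from the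
grading when `deg u` generates a cyclic `p`-group of unit degrees; that computation is not in this file).

* `isRegularLocalRing_localization_quotient_of_not_mem_sq` — the criterion for `T ⧸ (f)`;
* `isRegularLocalRing_localization_adjoinRoot_of_not_mem_sq` — the same for `AdjoinRoot f`, `f ∈ S[X]`, `S` a regular ring.

Honest label: helper toward ONE leaf stub; no stub, crux or summit closed. No definitions, no named facts, no sorry.
[cite: Matsumura1987, Thm. 14.2; Thm. 19.5]
-/

noncomputable section

-- single-problem summit: the doubled namespace component is forced
set_option linter.dupNamespace false

open IsLocalRing Polynomial
open Literature.AlgebraicGeometry.Resolution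

namespace Summit.ResolutionOfSingularities.ResolutionOfSingularities.Theorems.FRationalResolution.HypersurfaceLocalRegular

universe u

/-- **Hypersurface criterion.** `T` a regular ring, `f ∈ T`, `𝔓` a prime of `T/(f)` with preimage `𝔓'`; if the image of `f` in
`T_{𝔓'}` is not in the square of the maximal ideal, then `(T/(f))_𝔓` is a regular local ring. [cite: Matsumura1987, Thm. 14.2] -/
theorem isRegularLocalRing_localization_quotient_of_not_mem_sq {T : Type u} [CommRing T] [IsRegularRing T] (f : T)
    (𝔓 : Ideal (T ⧸ Ideal.span {f})) [𝔓.IsPrime]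
    (hf : algebraMap T (Localization.AtPrime (𝔓.comap (Ideal.Quotient.mk (Ideal.span {f})))) f ∉
      maximalIdeal (Localization.AtPrime (𝔓.comap (Ideal.Quotient.mk (Ideal.span {f})))) ^ 2) :
    IsRegularLocalRing (Localization.AtPrime 𝔓) := by
  haveI h𝔓' : (𝔓.comap (Ideal.Quotient.mk (Ideal.span {f}))).IsPrime := Ideal.IsPrime.comap _
  haveI : IsRegularLocalRing (Localization.AtPrime (𝔓.comap (Ideal.Quotient.mk (Ideal.span {f})))) :=
    IsRegularRing.isRegularLocalRing_localization _
  -- `f ∈ 𝔓'`, so its image lies in the maximal ideal of `T_{𝔓'}`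
  have hf0 : Ideal.Quotient.mk (Ideal.span {f}) f = 0 :=
    Ideal.Quotient.eq_zero_iff_mem.2 (Ideal.mem_span_singleton_self f)
  have hf𝔓' : f ∈ 𝔓.comap (Ideal.Quotient.mk (Ideal.span {f})) := by
    rw [Ideal.mem_comap, hf0]; exact 𝔓.zero_mem
  have hfm : algebraMap T (Localization.AtPrime (𝔓.comap (Ideal.Quotient.mk (Ideal.span {f})))) f ∈
      maximalIdeal (Localization.AtPrime (𝔓.comap (Ideal.Quotient.mk (Ideal.span {f})))) := by
    rw [← Localization.AtPrime.map_eq_maximalIdeal]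
    exact Ideal.mem_map_of_mem _ hf𝔓'
  -- `T_{𝔓'}/(f)` is regular local
  have hreg := (IsRegularLocalRing.quotient_span_singleton hfm hf).1
  have hmap : (Ideal.span {f}).map (algebraMap T (Localization.AtPrime (𝔓.comap (Ideal.Quotient.mk (Ideal.span {f}))))) =
      Ideal.span {algebraMap T (Localization.AtPrime (𝔓.comap (Ideal.Quotient.mk (Ideal.span {f})))) f} := by
    rw [Ideal.map_span, Set.image_singleton]
  -- `T_{𝔓'}/(f T_{𝔓'})` is the localization of `T/(f)` at `𝔓`
  have hM : Algebra.algebraMapSubmonoid (T ⧸ Ideal.span {f}) (𝔓.comap (Ideal.Quotient.mk (Ideal.span {f}))).primeCompl =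
      𝔓.primeCompl := by
    ext y
    constructor
    · rintro ⟨g, hg, rfl⟩
      exact fun h => hg (by rw [SetLike.mem_coe, Ideal.mem_comap]; exact h)
    · intro hy
      obtain ⟨g, rfl⟩ := Ideal.Quotient.mk_surjective y
      exact ⟨g, fun h => hy (by rwa [SetLike.mem_coe, Ideal.mem_comap] at h), rfl⟩
  haveI hloc : IsLocalization 𝔓.primeCompl (Localization.AtPrime (𝔓.comap (Ideal.Quotient.mk (Ideal.span {f}))) ⧸
      (Ideal.span {f}).map (algebraMap T (Localization.AtPrime (𝔓.comap (Ideal.Quotient.mk (Ideal.span {f})))))) := by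
    have h : IsLocalization (Algebra.algebraMapSubmonoid (T ⧸ Ideal.span {f})
        (𝔓.comap (Ideal.Quotient.mk (Ideal.span {f}))).primeCompl)
        (Localization.AtPrime (𝔓.comap (Ideal.Quotient.mk (Ideal.span {f}))) ⧸
          (Ideal.span {f}).map (algebraMap T (Localization.AtPrime (𝔓.comap (Ideal.Quotient.mk (Ideal.span {f})))))) :=
      inferInstance
    rwa [hM] at h
  haveI : IsRegularLocalRing (Localization.AtPrime (𝔓.comap (Ideal.Quotient.mk (Ideal.span {f}))) ⧸
      (Ideal.span {f}).map (algebraMap T (Localization.AtPrime (𝔓.comap (Ideal.Quotient.mk (Ideal.span {f})))))) := by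
    rw [hmap]; exact hreg
  exact IsRegularLocalRing.of_ringEquiv
    (IsLocalization.algEquiv 𝔓.primeCompl
      (Localization.AtPrime (𝔓.comap (Ideal.Quotient.mk (Ideal.span {f}))) ⧸
        (Ideal.span {f}).map (algebraMap T (Localization.AtPrime (𝔓.comap (Ideal.Quotient.mk (Ideal.span {f}))))))
      (Localization.AtPrime 𝔓)).toRingEquiv

/-- **Hypersurface criterion for `AdjoinRoot`.** `S` a regular ring, `f ∈ S[X]`, `𝔓` a prime of `AdjoinRoot f = S[X]/(f)` with
preimage `𝔓'` in `S[X]`: if the image of `f` in `S[X]_{𝔓'}` is not in the square of the maximal ideal, then `(AdjoinRoot f)_𝔓`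
is a regular local ring (`S[X]` is regular: Mathlib `Polynomial.isRegularRing_of_isRegularRing`). This is the certificate format
for the hypothesis `hreg` of `…FixedChartOfRoot.exists_fixed_chart_of_rootAdjoin`. [cite: Matsumura1987, Thm. 14.2; Thm. 19.5] -/
theorem isRegularLocalRing_localization_adjoinRoot_of_not_mem_sq {S : Type u} [CommRing S] [IsRegularRing S] (f : S[X])
    (𝔓 : Ideal (AdjoinRoot f)) [𝔓.IsPrime]
    (hf : algebraMap S[X] (Localization.AtPrime (𝔓.comap (AdjoinRoot.mk f))) f ∉
      maximalIdeal (Localization.AtPrime (𝔓.comap (AdjoinRoot.mk f))) ^ 2) :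
    IsRegularLocalRing (Localization.AtPrime 𝔓) :=
  @isRegularLocalRing_localization_quotient_of_not_mem_sq S[X] _ _ f 𝔓 ‹_› hf

end Summit.ResolutionOfSingularities.ResolutionOfSingularities.Theorems.FRationalResolution.HypersurfaceLocalRegular

end
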